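import Summits.CriticalPhenomena.PercolationContinuityZ3.Theorems.PercNearOneGluingAdditiveGluingSurplusTransfer
import HarnessLib

/-!
# `NoHeavyLowerTail` (stmt-CriticalPhenomena-4575) — the pair-attachment transfer (Q1)

Support file (`--supports stmt-CriticalPhenomena-4575`, prover prim-hp-8 gen 8, PL / best-member lane).  No named facts, no sorries,
no `Prop` definitions.

Setting: `μ = prodBernoulli w` (bond percolation with arbitrary edge weights on a finite vertex type), `F` monotone nonnegative on
vertex sets, a relay `a` (owner of the cluster `C(a)`), an observer `o` and a second observer `v ≠ a`; `m = ∫ F(C(a))`, `D = {v ↮ a}`.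
The tree's surplus transfer (S5)₁ = 4PT (`AGloc.surplusTransfer_single`, `Q7Psi.obs_cov_ge`, three seats) reads
`Cov(F(C_a), 1_{o↔a}) ≥ μ(o ↔ v | v ↮ a) · Cov(F(C_a), 1_{v↔a})`.  THIS FILE proves the PAIR-ATTACHMENT version

* `PairAttach.pairAttachTransfer` (Q1):  `μ(D ∩ {o↔v}) · (∫_{v↔a} F(C_a) − μ(v↔a)·m) ≤ μ(D) · (∫_{o↔a ∩ v↔a} F(C_a) − μ(o↔a ∩ v↔a)·m)`,
  i.e. `Cov(F(C_a), 1_{o↔a}·1_{v↔a}) ≥ μ(o ↔ v | v ↮ a) · Cov(F(C_a), 1_{v↔a})`: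
  the covariance of the cluster value with the JOINT attachment of both observers already carries the (S5)₁ share of the
  `v`-covariance.  It is not weaker than 4PT (`Cov(F(C_a), 1_{o↔a} 1_{v↮a})` has both signs; seat census 3098/7162 negative) and is
  census-clean (0/7162 exact instances, n ≤ 8).  Proof: Harris for `F(C_a)` on the increasing event `{o ↔ v}`, the two-cluster BHK
  inequality for `F(C_a)` and `{o ↔ v}` given `v ↮ a` (vdBHK Thm 1.4), and `{o↔v} = ({o↔a} ∩ {v↔a}) ⊔ ({o↔v} ∩ D)`.
Role (seat memo prim-hp-8/PROP2-FROM-COV.md, addendum (ii)–(iii)): (Q1) is the Harris+BHK core of the leaf case of the K-mixing term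
`P1` of the conditioned covariance transfer COV(τ)/CCT (the one open inequality behind (S5)₂, (GEN)/Kozma–Nitzan Conj. 1 for three
relays): there `(Q1)-slack ≥ E[(m − E_{K∖C(o)} F(C_a)) ; v ∈ C(a), o ∉ C(a)]` is what remains.
[cite: VandenbergHaggstromKahn2005, Thm. 1.4 (p. 7); §1 p. 6 (Harris)] [cite: KozmaNitzan2024, Conj. 4 (p. 32)]
-/

noncomputable section

namespace Summit.CriticalPhenomena.PercolationContinuityZ3.Theorems.PairAttach

open MeasureTheory Set
open Literature.Probability.LatticeModels (prodBernoulli)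
open Literature.Probability.Percolation Literature.Probability.Percolation.KNPreFKG
open Summit.CriticalPhenomena.PercolationContinuityZ3.Theorems.AGloc (setIntegral_clusterFun_ge)

variable {V : Type*} [Fintype V]

/-- **Pair-attachment transfer (Q1).**  For `F` monotone nonnegative on vertex sets, a relay `a`, an observer `o` and a second
observer `v ≠ a`, with `m = ∫ F(C(a))` and `D = {v ↮ a}`:
`μ(D ∩ {o ↔ v}) · (∫_{v ↔ a} F(C(a)) − μ(v ↔ a)·m) ≤ μ(D) · (∫_{o ↔ a ∩ v ↔ a} F(C(a)) − μ(o ↔ a ∩ v ↔ a)·m)`,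
i.e. `Cov(F(C_a), 1_{o↔a} 1_{v↔a}) ≥ P(o ↔ v | v ↮ a)·Cov(F(C_a), 1_{v↔a})`.  Proof: Harris for `F(C_a)` on `{o ↔ v}` plus the
two-cluster BHK inequality for `F(C_a)` and `{o ↔ v}` given `v ↮ a`, and `{o↔v} = ({o↔a} ∩ {v↔a}) ⊔ (D ∩ {o↔v})`.
[cite: VandenbergHaggstromKahn2005, Thm. 1.4 (p. 7)] -/
theorem pairAttachTransfer (w : Sym2 V → unitInterval) (o v a : V) (hva : v ≠ a) (F : Set V → ℝ)
    (hF : ∀ S T : Set V, S ⊆ T → F S ≤ F T) (hF0 : ∀ S, 0 ≤ F S) :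
    (prodBernoulli w).real ({ω : BondConfig V | ¬ (openGraph ω).Reachable v a} ∩ openConn o v) *
        (∫ ω in openConn v a, F (openCluster ω a) ∂(prodBernoulli w) -
          (prodBernoulli w).real (openConn v a) * ∫ ω, F (openCluster ω a) ∂(prodBernoulli w)) ≤
      (prodBernoulli w).real {ω : BondConfig V | ¬ (openGraph ω).Reachable v a} *
        (∫ ω in (openConn o a ∩ openConn v a : Set (BondConfig V)), F (openCluster ω a) ∂(prodBernoulli w) -
          (prodBernoulli w).real (openConn o a ∩ openConn v a : Set (BondConfig V)) * ∫ ω, F (openCluster ω a) ∂(prodBernoulli w)) := by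
  classical
  set μ := prodBernoulli w with hμ
  set f : BondConfig V → ℝ := fun ω => F (openCluster ω a) with hf
  set m : ℝ := ∫ ω, f ω ∂μ with hm
  have hmeas : ∀ T : Set (BondConfig V), MeasurableSet T := fun _ => MeasurableSet.of_discrete
  have hint : ∀ (k : BondConfig V → ℝ) (T : Set (BondConfig V)), IntegrableOn k T μ :=
    fun k T => (Integrable.of_finite).integrableOn
  have hn := fun (S : Set (BondConfig V)) => (measureReal_nonneg : 0 ≤ μ.real S)
  set D : Set (BondConfig V) := {ω | ¬ (openGraph ω).Reachable v a} with hD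
  set Oa : Set (BondConfig V) := openConn o a with hOa
  set Ov : Set (BondConfig V) := openConn o v with hOv
  set Q : Set (BondConfig V) := openConn v a with hQ
  -- (1) Harris on the increasing event `{o ↔ v}`
  have hHarris : μ.real Ov * m ≤ ∫ ω in Ov, f ω ∂μ :=
    setIntegral_clusterFun_ge w a F hF hF0 Ov (isUpperSet_openConn o v)
  -- (2) two-cluster BHK: `F(C_a)` and `{o ↔ v}` are negatively correlated given `v ↮ a`
  have hind : ∀ ω : BondConfig V, (connFamily v o).indicator (1 : Set (Sym2 V) → ℝ) (openEdgeCluster ω v) =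
      Ov.indicator (1 : BondConfig V → ℝ) ω := fun ω => by
    rw [congrFun (indicator_comp_openEdgeCluster (connFamily v o) v) ω, ← openConn_eq_setOf_connFamily, openConn_symm v o]
  have hprod : ∀ (T : Set (BondConfig V)) (k : BondConfig V → ℝ),
      ∫ ω in D, T.indicator (1 : BondConfig V → ℝ) ω * k ω ∂μ = ∫ ω in D ∩ T, k ω ∂μ := by
    intro T k
    rw [← setIntegral_mul_indicator_one μ D T k]
    refine setIntegral_congr_fun (hmeas D) fun ω _ => ?_
    ring
  have hBHK := BHK2006_twoClusterConditionalAssociation.negCorrelation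
    BHK2006_twoClusterConditionalAssociation_holds V w v a
    ((connFamily v o).indicator 1) (fun C => F {x | x = a ∨ ∃ e ∈ C, x ∈ e})
    (monotone_indicator_one_of_isUpperSet (isUpperSet_connFamily v o)) (monotone_clusterFun a F hF) hva
  simp only [clusterFun_openEdgeCluster, hind] at hBHK
  rw [setIntegral_indicator_one_eq, hprod Ov] at hBHK
  change μ.real D * ∫ ω in D ∩ Ov, f ω ∂μ ≤ μ.real (D ∩ Ov) * ∫ ω in D, f ω ∂μ at hBHK
  -- (3) `Ov = (Oa ∩ Q) ⊔ (D ∩ Ov)`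
  have hsub : Oa ∩ Q ⊆ Ov := by
    intro ω hω
    simp only [hOa, hQ, hOv, mem_inter_iff, openConn, mem_setOf_eq] at hω ⊢
    exact hω.1.trans hω.2.symm
  have hUdiff : Ov \ (Oa ∩ Q) = D ∩ Ov := by
    ext ω
    simp only [hOv, hOa, hQ, hD, mem_sdiff, mem_inter_iff, openConn, mem_setOf_eq, not_and]
    constructor
    · rintro ⟨hov, hn1⟩
      refine ⟨fun hva' => ?_, hov⟩
      exact hn1 (hov.trans hva') hva'
    · rintro ⟨hn', hov⟩
      exact ⟨hov, fun _ hva' => hn' hva'⟩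
  have hUint : ∫ ω in Ov, f ω ∂μ = ∫ ω in Oa ∩ Q, f ω ∂μ + ∫ ω in D ∩ Ov, f ω ∂μ := by
    rw [← integral_inter_add_sdiff (hmeas (Oa ∩ Q)) (hint f Ov), inter_eq_right.2 hsub, hUdiff]
  have hUμ : μ.real Ov = μ.real (Oa ∩ Q) + μ.real (D ∩ Ov) := by
    rw [← measureReal_inter_add_sdiff (s := Ov) (h := measure_ne_top _ _) (hmeas (Oa ∩ Q)), inter_eq_right.2 hsub, hUdiff]
  -- (4) `D = Qᶜ`
  have hDQ : D = Qᶜ := by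
    ext ω
    simp [hD, hQ, openConn]
  have hDint : ∫ ω in D, f ω ∂μ = m - ∫ ω in Q, f ω ∂μ := by
    have := integral_add_compl (hmeas Q) (Integrable.of_finite (f := f) (μ := μ))
    rw [← hDQ] at this
    linarith
  have hDμ : μ.real D = 1 - μ.real Q := by
    have h1 : μ.real (univ : Set (BondConfig V)) = μ.real (univ ∩ Q) + μ.real (univ \ Q) :=
      (measureReal_inter_add_sdiff (s := univ) (h := measure_ne_top _ _) (hmeas Q)).symm
    rw [probReal_univ, univ_inter, ← compl_eq_univ_sdiff, ← hDQ] at h1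
    linarith
  -- assemble
  have hm0 : 0 ≤ m := integral_nonneg fun ω => hF0 _
  have hA : ∫ ω in Oa ∩ Q, f ω ∂μ - μ.real (Oa ∩ Q) * m ≥ μ.real (D ∩ Ov) * m - ∫ ω in D ∩ Ov, f ω ∂μ := by
    rw [hUint, hUμ] at hHarris
    linarith
  have hB : μ.real D * (μ.real (D ∩ Ov) * m - ∫ ω in D ∩ Ov, f ω ∂μ) ≥
      μ.real D * (μ.real (D ∩ Ov) * m) - μ.real (D ∩ Ov) * ∫ ω in D, f ω ∂μ := by
    rw [mul_sub]
    linarith [hBHK]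
  have hC := mul_le_mul_of_nonneg_left hA (hn D)
  rw [hDint, hDμ] at hB
  rw [hDμ] at hC ⊢
  nlinarith [hB, hC, hn (D ∩ Ov), hn Q]

end Summit.CriticalPhenomena.PercolationContinuityZ3.Theorems.PairAttach

end
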